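import Literature.NumberTheory.Transcendental.RoySmallValueEstimatesInstantiationProofs
import Literature.NumberTheory.Transcendental.RoySmallValueEstimatesProp14Proofs
import HarnessLib

/-!
# Small value estimates at rational translates (Nguyen–Roy 2016) — proofs, XXIII: Theorem 1 reduced to the arithmetic Bézout bound and Corollary 16 (the wall reduction)

Twenty-third proofs file towards `Literature.NumberTheory.Transcendental.nguyenRoy2016_thm_1` (Nguyen–Roy,
IJNT 12 (2016) = arXiv:1412.5163). Everything here is PROVED; no named facts. Files VIII and XIX
reduced Theorem 1 to the hypothesis structure `WallData` (Propositions 14, 15, Corollary 16 in the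
concrete terms of the instantiation); file XXII proved the combinatorial half of Proposition 14 from
the arithmetic Bézout input `ZeroBounds`. This file packages what is left:

* `Cor16Data ξ η r s σ β ν Pt D₁` — **Proposition 15 with Corollary 16**: subvarieties
  `Z_D ⊆ W_D` (an algebraic point `Z D` with `IsIn`) with
  `∑_{α ∈ Z_D} (D^β + log dist(α, γ_{ι α})) ≤ −κ D^{ν−β+σ−2} (2D^β deg Z_D + D h(Z_D))`, `0 ≤ ι α < ⌊D^σ⌋`,
  for `D ≥ D₁` (a bundle of hypotheses, nothing asserted);
* `wallData_of_zeroBounds_cor16` — `WallData` at a suitable level from `ZeroBounds` at every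
  `D ≥ D₀` and a `Cor16Data`;
* **`nguyenRoy2016_thm_1_of_zeroBounds_cor16`** — Theorem 1 follows as soon as, for every
  `(ξ, η) ∉ ℚ̄ × ℚ̄` (and the other data of Theorem 1) and every sequence `P̃_D` with the properties
  of Proposition 4 from some `D₀` on, one has (i) a constant `B_z` with `ZeroBounds` for all
  `D ≥ D₀` — *the common zeros of `P̃_D` and `∑_{i=1}^D tⁱΦⁱP̃_D` (some `t`) number at most `D²`
  with absolute heights summing to `≤ B_z D^{1+β}`* — and (ii) a `Cor16Data` from some `D₁` on.

## References

* [NguyenRoy2016] N. A. V. Nguyen, D. Roy, IJNT 12 (2016) 1273–1293 = arXiv:1412.5163, §5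
  (Props. 14, 15, Cor. 16), §6 (proof of Theorem 1).
-/

noncomputable section

open Height Module Finset MvPolynomial Filter
open scoped Classical

namespace Literature.NumberTheory.Transcendental

namespace NguyenRoy

section reduction

variable (ξ η : ℂ) (r s : ℚ) (σ β ν : ℝ) (Pt : ℕ → MvPolynomial (Fin 3) ℤ) (D₁ : ℕ)

/-- **Proposition 15 with Corollary 16** for the data `(ξ, η, r, s, σ, β, ν)` and the polynomials
`P̃_D = Pt D`, from the level `D₁` on, in the concrete terms of the instantiation: the subvarieties
`Z_D ⊆ W_D` (recorded by a point) and the small-value estimate of Corollary 16 with the closest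
indices `ι`. Nothing is asserted. [cite: NguyenRoy2016, Proposition 15, Corollary 16] -/
structure Cor16Data : Type where
  /-- Proposition 15: the subvarieties `Z_D ⊆ W_D`. -/
  Z : ℕ → AlgPt
  isIn_Z : ∀ D : ℕ, D₁ ≤ D → IsIn r s σ Pt (Z D) D
  /-- Corollary 16. -/
  κ : ℝ
  κ_pos : 0 < κ
  cor16 : ∀ D : ℕ, D₁ ≤ D → ∃ ι : PPt → ℤ,
    (∀ a ∈ (Z D).conj, 0 ≤ ι a ∧ ι a < (⌊(D : ℝ) ^ σ⌋₊ : ℕ)) ∧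
    ∑ a ∈ (Z D).conj, ((D : ℝ) ^ β + Real.log (pdist a (gamP ξ η (r : ℂ) (s : ℂ) (ι a)))) ≤
      -(κ * (D : ℝ) ^ (ν - β + σ - 2) * (2 * (D : ℝ) ^ β * ((Z D).conj).card + D * (Z D).ht))

variable {ξ η r s σ β ν Pt D₁}

/-- **`WallData` from the arithmetic Bézout bound and Corollary 16.** [cite: NguyenRoy2016, §5] -/
theorem exists_wallData_of_zeroBounds_cor16 (hr : r ≠ 0) (hs : s ≠ 0) (hs1 : s ≠ 1) (hs2 : s ≠ -1)
    (hσ1 : 1 ≤ σ) (hσ2 : σ < 2) (hβ : σ + 1 < β) {D₀ : ℕ}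
    (hPt : ∀ D : ℕ, D₀ ≤ D → PropsAt ξ η r s σ β ν Pt D)
    {Bz : ℝ} (hBz : 0 ≤ Bz) (hZB : ∀ D : ℕ, D₀ ≤ D → ZeroBounds r s β Pt Bz D)
    (hD₁ : D₀ ≤ D₁) (C : Cor16Data ξ η r s σ β ν Pt D₁) :
    ∃ D₂ : ℕ, D₀ ≤ D₂ ∧ Nonempty (WallData ξ η r s hs σ β ν Pt D₂) := by
  obtain ⟨D₁', hD₁', h14⟩ := prop14_of_zeroBounds (ξ := ξ) (η := η) (ν := ν)
    hr hs hs1 hs2 hσ1 hσ2 hβ hBz hPt hZB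
  refine ⟨max D₁ D₁', hD₁.trans (le_max_left _ _), ⟨?_⟩⟩
  exact
    { A₁₄ := 2
      B₁₄ := 2 * Bz + 7 * AlgPt.c4 r s + 1
      one_le_A₁₄ := by norm_num
      one_le_B₁₄ := by have := AlgPt.c4_nonneg r hs; linarith
      prop14 := fun D hD Z hZ i hi => h14 D ((le_max_right _ _).trans hD) Z hZ i hi
      Z := C.Z
      isIn_Z := fun D hD => C.isIn_Z D ((le_max_left _ _).trans hD)
      κ := C.κ
      κ_pos := C.κ_pos
      cor16 := fun D hD => C.cor16 D ((le_max_left _ _).trans hD) }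

/-- **Theorem 1 of Nguyen–Roy reduced to the arithmetic Bézout bound and Corollary 16.** If for
every `(ξ, η) ∉ ℚ̄ × ℚ̄` with the data of Theorem 1 and every sequence `P̃_D` with the properties
of Proposition 4 from some `D₀` on there are (i) a constant `B_z ≥ 0` with `ZeroBounds` for all
`D ≥ D₀` and (ii) a `Cor16Data` from some `D₁ ≥ D₀` on, then `nguyenRoy2016_thm_1` holds.
[cite: NguyenRoy2016, Theorem 1 (structure of the proof: Props. 4, 14, 15, 16, 17, §6)] -/
theorem nguyenRoy2016_thm_1_of_zeroBounds_cor16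
    (bezout : ∀ (ξ η : ℂ), η ≠ 0 → ¬ (IsAlgebraic ℚ ξ ∧ IsAlgebraic ℚ η) →
      ∀ (r s : ℚ), r ≠ 0 → s ≠ 0 → s ≠ 1 → s ≠ -1 → ∀ (σ β ν : ℝ), 1 ≤ σ → σ < 2 → σ + 1 < β →
      ∀ (Pt : ℕ → MvPolynomial (Fin 3) ℤ) (D₀ : ℕ),
        (∀ D : ℕ, D₀ ≤ D → PropsAt ξ η r s σ β ν Pt D) → (∀ D : ℕ, D₀ ≤ D → SuppAt Pt D) →
        ∃ Bz : ℝ, 0 ≤ Bz ∧ ∀ D : ℕ, D₀ ≤ D → ZeroBounds r s β Pt Bz D)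
    (cor16 : ∀ (ξ η : ℂ), η ≠ 0 → ¬ (IsAlgebraic ℚ ξ ∧ IsAlgebraic ℚ η) →
      ∀ (r s : ℚ) (hs : s ≠ 0), r ≠ 0 → s ≠ 1 → s ≠ -1 → ∀ (σ β ν : ℝ), 1 ≤ σ → σ < 2 → σ + 1 < β →
      2 + β - σ < ν →
      ∀ (Pt : ℕ → MvPolynomial (Fin 3) ℤ) (D₀ : ℕ),
        (∀ D : ℕ, D₀ ≤ D → PropsAt ξ η r s σ β ν Pt D) → (∀ D : ℕ, D₀ ≤ D → SuppAt Pt D) →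
        ∃ D₁ : ℕ, D₀ ≤ D₁ ∧ Nonempty (Cor16Data ξ η r s σ β ν Pt D₁)) :
    nguyenRoy2016_thm_1 := by
  refine nguyenRoy2016_thm_1_of_wall
    fun ξ η hη hξη r s hs hr hs1 hs2 σ β ν hσ1 hσ2 hβ hν Pt D₀ hPt hSupp => ?_
  obtain ⟨Bz, hBz, hZB⟩ := bezout ξ η hη hξη r s hr hs hs1 hs2 σ β ν hσ1 hσ2 hβ Pt D₀ hPt hSupp
  obtain ⟨D₁, hD₁, ⟨C⟩⟩ := cor16 ξ η hη hξη r s hs hr hs1 hs2 σ β ν hσ1 hσ2 hβ hν Pt D₀ hPt hSupp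
  exact exists_wallData_of_zeroBounds_cor16 hr hs hs1 hs2 hσ1 hσ2 hβ hPt hBz hZB hD₁ C

end reduction

end NguyenRoy

end Literature.NumberTheory.Transcendental

end
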